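import Mathlib

/-!
# Alternating pairings on finite abelian groups: the `p`-rank is even

Pure algebra, used by `Literature.NumberTheory.EllipticCurves.CasselsTateParity` (the parity
relation `dim_{𝔽_p} Ш(E/K)[p] ≡ corank_{ℤ_p} Ш(E/K)[p^∞] (mod 2)` behind the `p`-Selmer-rank form
of the `p`-parity theorem, Dokchitser–Dokchitser 2010 / Bhargava–Shankar 2015 Thm 42), but stated
and proved in general:

* `even_finrank_of_isAlt_of_nondegenerate`: a nondegenerate alternating bilinear form on a
  finite-dimensional vector space over a field has even dimension (orthogonal splitting off of a
  hyperbolic plane, Mathlib's `LinearMap.BilinForm.isCompl_orthogonal_of_restrict_nondegenerate`,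
  and induction on the dimension).
* `separatingRight_of_separatingLeft_of_finrank_eq`: a pairing `V × W → K` of finite-dimensional
  spaces of equal dimension with trivial left kernel has trivial right kernel.
* `exists_natCard_torsionBy_eq_pow_two_mul`: **a finite abelian group `T` carrying a bi-additive
  pairing `B : T × T → Q` which is alternating (`B(x, x) = 0`) and nondegenerate has
  `#T[p] = p^{2k}`** for every prime `p` such that `Q[p]` embeds in `ℤ/p` — in particular for
  `Q = ℚ/ℤ` (`exists_natCard_torsionBy_eq_pow_two_mul_of_circle`, with `(ℚ/ℤ)[p] ≅ ℤ/p`,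
  `exists_circleTorsion_toZMod_injective`). Classically such a `T` is isomorphic to `M × M` (for
  `T = Ш(E/K)/div` with the Cassels–Tate pairing: Cassels 1962, Tate 1963; Poonen–Stoll, Ann. of
  Math. 150 (1999), §1); only the parity of the `p`-rank is proved here, which is what the
  corank computations of the tree consume.

## Proof of the `p`-rank statement

Induction on `#T`. Let `V = T[p]`, an `𝔽_p`-vector space, with the `𝔽_p`-valued form
`(x, y) ↦ ι(B(x, y))` (values of `B` on `T[p] × T` lie in `Q[p]`, `apply_mem_torsionBy`). Its
radical is `R = T[p] ∩ pT`: `⊇` because `B(pt, y) = B(t, py) = 0`, and `⊆`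
because the induced pairing `T[p] × T/pT → 𝔽_p` has trivial left kernel and `#T[p] = #(T/pT)`
(`natCard_torsionBy_eq_natCard_modN`), hence trivial right kernel
(`mem_range_nsmul_of_forall_torsionBy`). A complement of `R` in `V` is a nondegenerate alternating
space, of even dimension, so `#T[p] = #R · p^{2j}` (`natCard_torsionBy_eq_mul_sq`). Finally
`R ≅ (T/T[p])[p]` by `ā ↦ pa` (`natCard_torsionBy_quot_eq`), and `T/T[p]` carries the
nondegenerate alternating pairing `B'(ā, b̄) = B(pa, b)` (`exists_quotTorsionPairing`) and has
smaller order unless `T[p] = 0`.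

## Design

`T[n]` is Mathlib's `AddSubgroup.torsionBy` (scoped notation), `T/pT` is Mathlib's `ModN T p`,
`ℚ/ℤ` is `AddCircle (1 : ℚ)` (as in `WeierstrassCurve.exists_casselsTate_pairing`). Pairings are
curried additive homomorphisms `T →+ T →+ Q`; nondegeneracy is stated on the left (alternating
pairings are antisymmetric, `eq_neg_of_alternating`). Everything is a `theorem` (auxiliary maps
are built inside the proofs); no number theory is imported.
-/

noncomputable section

open Module LinearMap
open scoped AddSubgroup

namespace Literature.GroupTheory.FiniteAbelian

universe u v

section Field

variable {K : Type u} [Field K]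

/-- A nondegenerate alternating bilinear form on a finite-dimensional vector space has even
dimension (the space is an orthogonal sum of hyperbolic planes). [folklore] -/
theorem even_finrank_of_isAlt_of_nondegenerate {V : Type v} [AddCommGroup V] [Module K V]
    [FiniteDimensional K V] {B : LinearMap.BilinForm K V} (halt : B.IsAlt)
    (hnd : B.Nondegenerate) : Even (finrank K V) := by
  suffices key : ∀ (n : ℕ) (V : Type v) [AddCommGroup V] [Module K V] [FiniteDimensional K V]
      (B : LinearMap.BilinForm K V), B.IsAlt → B.Nondegenerate → finrank K V = n →
      Even (finrank K V) from key _ V B halt hnd rfl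
  intro n
  induction n using Nat.strong_induction_on with
  | _ n ih =>
  intro V _ _ _ B halt hnd hn
  have hrefl : B.IsRefl := LinearMap.IsAlt.isRefl halt
  rcases Nat.eq_zero_or_pos (finrank K V) with hV | hV
  · rw [hV]; exact ⟨0, rfl⟩
  -- pick `x ≠ 0` and `y` with `B x y = 1`
  obtain ⟨x, hx⟩ : ∃ x : V, x ≠ 0 := Module.finrank_pos_iff_exists_ne_zero.mp hV
  obtain ⟨y₀, hy₀⟩ : ∃ y : V, B x y ≠ 0 := not_forall.mp fun h ↦ hx (hnd.1 x h)
  obtain ⟨y, hxy⟩ : ∃ y : V, B x y = 1 :=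
    ⟨(B x y₀)⁻¹ • y₀, by rw [map_smul, smul_eq_mul, inv_mul_cancel₀ hy₀]⟩
  have hyx : B y x = -1 := by rw [← LinearMap.IsAlt.neg halt x y, hxy]
  have hxx : B x x = 0 := halt x
  have hyy : B y y = 0 := halt y
  -- the hyperbolic plane `W = ⟨x, y⟩`
  set W : Submodule K V := Submodule.span K {x, y} with hW
  have hxW : x ∈ W := Submodule.subset_span (by simp)
  have hyW : y ∈ W := Submodule.subset_span (by simp)
  have hmemW : ∀ w ∈ W, ∃ a b : K, a • x + b • y = w := fun w hw ↦
    Submodule.mem_span_pair.mp hw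
  -- `finrank W = 2`
  have hli : LinearIndependent K ![x, y] := by
    rw [LinearIndependent.pair_iff]
    intro s t hst
    have h1 : B x (s • x + t • y) = 0 := by rw [hst, map_zero]
    have h2 : B y (s • x + t • y) = 0 := by rw [hst, map_zero]
    rw [map_add, map_smul, map_smul, smul_eq_mul, smul_eq_mul, hxx, hxy] at h1
    rw [map_add, map_smul, map_smul, smul_eq_mul, smul_eq_mul, hyx, hyy] at h2
    constructor
    · linear_combination -h2
    · linear_combination h1
  have hW2 : finrank K W = 2 := by
    have hrange : Set.range ![x, y] = {x, y} := by
      rw [Matrix.range_cons, Matrix.range_cons, Matrix.range_empty, Set.union_empty,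
        ← Set.insert_eq]
    have := finrank_span_eq_card hli
    rw [hrange] at this
    simpa using this
  -- `B` restricted to `W` is nondegenerate
  have hWnd : (B.restrict W).Nondegenerate := by
    refine (LinearMap.IsRefl.nondegenerate_iff_separatingLeft (B := B.restrict W)
      fun a b h ↦ hrefl (a : V) (b : V) h).mpr ?_
    intro w hw
    obtain ⟨a, b, hab⟩ := hmemW w w.2
    have h1 := hw ⟨y, hyW⟩
    have h2 := hw ⟨x, hxW⟩
    simp only [LinearMap.BilinForm.restrict_apply, LinearMap.domRestrict_apply] at h1 h2
    rw [← hab, map_add, map_smul, map_smul, LinearMap.add_apply, LinearMap.smul_apply,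
      LinearMap.smul_apply, smul_eq_mul, smul_eq_mul] at h1 h2
    rw [hxy, hyy] at h1
    rw [hxx, hyx] at h2
    apply Subtype.ext
    rw [← hab]
    have ha : a = 0 := by linear_combination h1
    have hb : b = 0 := by linear_combination -h2
    simp [ha, hb]
  -- `V = W ⊕ W^⊥`, and `B` restricted to `W^⊥` is alternating and nondegenerate
  have hcompl : IsCompl W (B.orthogonal W) :=
    LinearMap.BilinForm.isCompl_orthogonal_of_restrict_nondegenerate hrefl hWnd
  set W' : Submodule K V := B.orthogonal W with hW'
  have hW'nd : (B.restrict W').Nondegenerate := by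
    rw [LinearMap.BilinForm.restrict_nondegenerate_iff_isCompl_orthogonal hrefl, hW',
      LinearMap.BilinForm.orthogonal_orthogonal hnd hrefl]
    exact hcompl.symm
  have hW'alt : (B.restrict W').IsAlt := fun w ↦ halt (w : V)
  have hdim : finrank K W + finrank K W' = finrank K V := Submodule.finrank_add_eq_of_isCompl hcompl
  have hlt : finrank K W' < n := by omega
  have heven : Even (finrank K W') := ih _ hlt W' (B.restrict W') hW'alt hW'nd rfl
  rw [← hdim, hW2]
  exact (even_two).add heven

/-- A pairing `β : V × W → K` between finite-dimensional vector spaces of the same dimension with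
trivial left kernel also has trivial right kernel (`V → W^*` injective between spaces of equal
dimension is surjective, and `W^*` separates the points of `W`). [folklore] -/
theorem separatingRight_of_separatingLeft_of_finrank_eq {V : Type v} {W : Type*} [AddCommGroup V]
    [Module K V] [AddCommGroup W] [Module K W] [FiniteDimensional K V] [FiniteDimensional K W]
    (β : V →ₗ[K] W →ₗ[K] K) (hl : β.SeparatingLeft) (h : finrank K V = finrank K W) :
    β.SeparatingRight := by
  have hinj : Function.Injective β := by
    rw [← LinearMap.ker_eq_bot]
    exact LinearMap.separatingLeft_iff_ker_eq_bot.mp hl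
  have hsurj : Function.Surjective β :=
    (LinearMap.injective_iff_surjective_of_finrank_eq_finrank
      (h.trans (Subspace.dual_finrank_eq).symm)).mp hinj
  intro w hw
  refine (Module.forall_dual_apply_eq_zero_iff K w).mp fun φ ↦ ?_
  obtain ⟨v, rfl⟩ := hsurj φ
  exact hw v

end Field

section FiniteGroup

variable {T : Type u} [AddCommGroup T] {Q : Type v} [AddCommGroup Q]

/-- An alternating bi-additive pairing is antisymmetric: `B x y = -B y x`. [folklore] -/
theorem eq_neg_of_alternating (B : T →+ T →+ Q) (halt : ∀ x, B x x = 0) (x y : T) :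
    B x y = -B y x := by
  have h := halt (x + y)
  simp only [map_add, AddMonoidHom.add_apply, halt x, halt y, zero_add, add_zero] at h
  rw [eq_neg_iff_add_eq_zero]
  first
  | exact h
  | rwa [add_comm] at h

/-- For `x ∈ T[p]` the values `B x y` lie in `Q[p]` (`p • B x y = B (p • x) y = 0`). [folklore] -/
theorem apply_mem_torsionBy (B : T →+ T →+ Q) (p : ℕ) {x : T} (hx : x ∈ T[(p : ℤ)]) (y : T) :
    B x y ∈ Q[(p : ℤ)] :=
  AddSubgroup.torsionBy.nsmul_iff.mpr (by
    rw [← AddMonoidHom.flip_apply B, ← map_nsmul, AddSubgroup.torsionBy.nsmul_iff.mp hx, map_zero])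

/-- `B (p • t) y = 0` for `y ∈ T[p]` (`= B t (p • y)`). [folklore] -/
theorem apply_nsmul_apply_eq_zero (B : T →+ T →+ Q) (p : ℕ) (t : T) {y : T}
    (hy : y ∈ T[(p : ℤ)]) : B (p • t) y = 0 := by
  rw [map_nsmul, AddMonoidHom.nsmul_apply, ← map_nsmul, AddSubgroup.torsionBy.nsmul_iff.mp hy,
    map_zero]

variable (p : ℕ)

/-- The multiples of `p`, `pT`, are the `ℤ`-span subgroup `range (lsmul ℤ T p)` used by `ModN T p`.
[folklore] -/
theorem range_nsmulAddMonoidHom_eq :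
    (nsmulAddMonoidHom (α := T) p).range =
      (LinearMap.range (LinearMap.lsmul ℤ T p)).toAddSubgroup := by
  ext x
  simp only [AddMonoidHom.mem_range, nsmulAddMonoidHom_apply, Submodule.mem_toAddSubgroup,
    LinearMap.mem_range, LinearMap.lsmul_apply, natCast_zsmul]

/-- The kernel of multiplication by `p` is `T[p]`. [folklore] -/
theorem ker_nsmulAddMonoidHom_eq : (nsmulAddMonoidHom (α := T) p).ker = T[(p : ℤ)] := by
  ext x
  rw [AddMonoidHom.mem_ker, nsmulAddMonoidHom_apply, AddSubgroup.torsionBy.nsmul_iff]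

/-- `T/pT` is finite for `T` finite. [folklore] -/
theorem finite_modN [Finite T] : Finite (ModN T p) :=
  Finite.of_surjective _ (Submodule.mkQ_surjective _)

/-- For a finite abelian group `T`, `#T[p] = #(T/pT)` (both equal `#T / #pT`). [folklore] -/
theorem natCard_torsionBy_eq_natCard_modN [Finite T] :
    Nat.card T[(p : ℤ)] = Nat.card (ModN T p) := by
  set m : T →+ T := nsmulAddMonoidHom p with hm
  set R : AddSubgroup T := (LinearMap.range (LinearMap.lsmul ℤ T p)).toAddSubgroup with hR
  have h1 := AddSubgroup.card_eq_card_quotient_mul_card_addSubgroup m.ker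
  have h2 := AddSubgroup.card_eq_card_quotient_mul_card_addSubgroup R
  rw [Nat.card_congr (QuotientAddGroup.quotientKerEquivRange m).toEquiv] at h1
  rw [ker_nsmulAddMonoidHom_eq] at h1
  have h3 : Nat.card R = Nat.card m.range := by rw [hR, ← range_nsmulAddMonoidHom_eq]
  have h4 : Nat.card (T ⧸ R) = Nat.card (ModN T p) := rfl
  rw [h3, h4, mul_comm] at h2
  have hpos : 0 < Nat.card m.range := Nat.card_pos
  exact Nat.eq_of_mul_eq_mul_left hpos (h1.symm.trans h2)

/-! ### Passing to `T / T[p]` -/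

/-- **The induced pairing on `T' = T / T[p]`.** A bi-additive alternating nondegenerate pairing `B`
on `T` induces `B'(ā, b̄) = B(pa, b) = B(a, pb)` on `T / T[p]` (well defined: `B(pa, b)` vanishes
if `a` or `b` is `p`-torsion), again alternating and nondegenerate. [folklore] -/
theorem exists_quotTorsionPairing (B : T →+ T →+ Q) (halt : ∀ x, B x x = 0)
    (hnd : ∀ x, (∀ y, B x y = 0) → x = 0) :
    ∃ B' : T ⧸ T[(p : ℤ)] →+ T ⧸ T[(p : ℤ)] →+ Q,
      (∀ z, B' z z = 0) ∧ ∀ z, (∀ w, B' z w = 0) → z = 0 := by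
  let L : T →+ (T ⧸ T[(p : ℤ)] →+ Q) :=
    { toFun := fun a ↦ QuotientAddGroup.lift (T[(p : ℤ)]) (B (p • a)) (by
        intro b hb
        rw [AddMonoidHom.mem_ker]
        exact apply_nsmul_apply_eq_zero B p a hb)
      map_zero' := QuotientAddGroup.addMonoidHom_ext _ (by
        ext b
        change B (p • (0 : T)) b = 0
        rw [smul_zero, map_zero, AddMonoidHom.zero_apply])
      map_add' := fun a a' ↦ QuotientAddGroup.addMonoidHom_ext _ (by
        ext b
        change B (p • (a + a')) b = B (p • a) b + B (p • a') b
        rw [smul_add, map_add, AddMonoidHom.add_apply]) }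
  have hL : T[(p : ℤ)] ≤ L.ker := by
    intro a ha
    rw [AddMonoidHom.mem_ker]
    refine QuotientAddGroup.addMonoidHom_ext _ ?_
    ext b
    change B (p • a) b = 0
    rw [AddSubgroup.torsionBy.nsmul_iff.mp ha, map_zero, AddMonoidHom.zero_apply]
  refine ⟨QuotientAddGroup.lift (T[(p : ℤ)]) L hL, ?_, ?_⟩
  · intro z
    induction z using QuotientAddGroup.induction_on with
    | H a =>
      change B (p • a) a = 0
      rw [map_nsmul, AddMonoidHom.nsmul_apply, halt, smul_zero]
  · intro z hz
    induction z using QuotientAddGroup.induction_on with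
    | H a =>
      rw [QuotientAddGroup.eq_zero_iff, AddSubgroup.torsionBy.nsmul_iff]
      exact hnd _ fun y ↦ hz (QuotientAddGroup.mk y)

/-- **`(T/T[p])[p] ≅ T[p] ∩ pT`** via `ā ↦ pa` (multiplication by `p` descends to an injection
`T/T[p] → T` mapping the `p`-torsion onto `T[p] ∩ pT`); in particular the two groups have the same
cardinality. [folklore] -/
theorem natCard_torsionBy_quot_eq :
    Nat.card (T ⧸ T[(p : ℤ)])[(p : ℤ)] =
      Nat.card ↥(T[(p : ℤ)] ⊓ (nsmulAddMonoidHom (α := T) p).range) := by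
  let ψ : T ⧸ T[(p : ℤ)] →+ T := QuotientAddGroup.lift (T[(p : ℤ)]) (nsmulAddMonoidHom p) (by
    intro a ha
    rwa [AddMonoidHom.mem_ker, nsmulAddMonoidHom_apply, ← AddSubgroup.torsionBy.nsmul_iff])
  have hψ : ∀ a : T, ψ (QuotientAddGroup.mk a) = p • a := fun _ ↦ rfl
  have hinj : Function.Injective ψ := by
    rw [injective_iff_map_eq_zero]
    intro z hz
    induction z using QuotientAddGroup.induction_on with
    | H a =>
      rw [QuotientAddGroup.eq_zero_iff, AddSubgroup.torsionBy.nsmul_iff]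
      exact hz
  refine Nat.card_congr (Equiv.ofBijective
    (fun z ↦ ⟨ψ (z : T ⧸ T[(p : ℤ)]), AddSubgroup.mem_inf.mpr ⟨?_, ?_⟩⟩) ⟨?_, ?_⟩)
  · -- `p • (p a) = 0`
    rw [AddSubgroup.torsionBy.nsmul_iff, ← map_nsmul, AddSubgroup.torsionBy.nsmul_iff.mp z.2,
      map_zero]
  · obtain ⟨a, ha⟩ := QuotientAddGroup.mk_surjective (z : T ⧸ T[(p : ℤ)])
    exact ⟨a, by rw [← ha]; rfl⟩
  · intro z w hzw
    exact Subtype.ext (hinj (congrArg Subtype.val hzw))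
  · rintro ⟨x, hxN, t, rfl⟩
    refine ⟨⟨QuotientAddGroup.mk t, ?_⟩, rfl⟩
    rw [AddSubgroup.torsionBy.nsmul_iff, ← QuotientAddGroup.mk_nsmul, QuotientAddGroup.eq_zero_iff]
    exact hxN

variable [hp : Fact p.Prime]

/-- For a finite `𝔽_p`-vector space `V`, `p ^ dim V = #V`. [folklore] -/
theorem pow_finrank_eq_natCard (V : Type*) [AddCommGroup V] [Module (ZMod p) V] [Finite V] :
    p ^ finrank (ZMod p) V = Nat.card V := by
  haveI : Module.Finite (ZMod p) V := Module.Finite.of_finite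
  rw [Module.natCard_eq_pow_finrank (K := ZMod p), Nat.card_zmod]

/-! ### The radical of the pairing on `T[p]` is `T[p] ∩ pT` -/

/-- **The orthogonal of `T[p]` is `pT`.** For a finite abelian group `T` with a nondegenerate
alternating pairing `B : T × T → Q` whose `p`-torsion values embed in `𝔽_p` (`ι`), an element `x`
with `B x y = 0` for all `y ∈ T[p]` is a multiple of `p`: the induced pairing
`T[p] × T/pT → 𝔽_p` has trivial left kernel and `#T[p] = #T/pT`, hence trivial right kernel
(`separatingRight_of_separatingLeft_of_finrank_eq`). [folklore] -/
theorem mem_range_nsmul_of_forall_torsionBy [Finite T] (B : T →+ T →+ Q) (halt : ∀ x, B x x = 0)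
    (hnd : ∀ x, (∀ y, B x y = 0) → x = 0) (ι : Q[(p : ℤ)] →+ ZMod p) (hι : Function.Injective ι)
    {x : T} (h : ∀ y ∈ T[(p : ℤ)], B x y = 0) :
    x ∈ (nsmulAddMonoidHom (α := T) p).range := by
  letI : Module (ZMod p) T[(p : ℤ)] := AddSubgroup.torsionBy.zmodModule
  haveI : Finite (ModN T p) := finite_modN p
  set R : AddSubgroup T := (LinearMap.range (LinearMap.lsmul ℤ T p)).toAddSubgroup with hR
  -- `B` on `T[p] × T` takes values in `Q[p]`; compose with `ι`
  let tP : T[(p : ℤ)] →+ T →+ Q[(p : ℤ)] :=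
    { toFun := fun v ↦ (B (v : T)).codRestrict (Q[(p : ℤ)]) (apply_mem_torsionBy B p v.2)
      map_zero' := by ext; simp
      map_add' := fun v w ↦ by ext; simp }
  have htP : ∀ (v : T[(p : ℤ)]) (t : T), ((tP v t : Q[(p : ℤ)]) : Q) = B v t := fun _ _ ↦ rfl
  let b₁ : T[(p : ℤ)] →+ T →+ ZMod p := (AddMonoidHom.compHom ι).comp tP
  have hb₁ : ∀ (v : T[(p : ℤ)]) (t : T), b₁ v t = ι (tP v t) := fun _ _ ↦ rfl
  -- it kills `pT` in `t`, and descends to the pairing `T[p] × T/pT → 𝔽_p`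
  have hkill : ∀ v : T[(p : ℤ)], R ≤ (b₁ v).ker := by
    rintro v _ ⟨t, rfl⟩
    rw [AddMonoidHom.mem_ker, hb₁, LinearMap.lsmul_apply, map_zsmul, natCast_zsmul,
      AddSubgroup.torsionBy.nsmul, map_zero]
  let b₀ : T[(p : ℤ)] →+ (ModN T p →+ ZMod p) :=
    { toFun := fun v ↦ QuotientAddGroup.lift R (b₁ v) (hkill v)
      map_zero' := QuotientAddGroup.addMonoidHom_ext R (by
        ext t
        change b₁ 0 t = 0
        rw [map_zero, AddMonoidHom.zero_apply])
      map_add' := fun v w ↦ QuotientAddGroup.addMonoidHom_ext R (by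
        ext t
        change b₁ (v + w) t = b₁ v t + b₁ w t
        rw [map_add, AddMonoidHom.add_apply]) }
  let β : T[(p : ℤ)] →ₗ[ZMod p] ModN T p →ₗ[ZMod p] ZMod p :=
    ((AddMonoidHom.toZModLinearMapEquiv p).toAddMonoidHom.comp b₀).toZModLinearMap p
  have hβ : ∀ (v : T[(p : ℤ)]) (t : T), β v (QuotientAddGroup.mk t) = ι (tP v t) :=
    fun v t ↦ rfl
  -- trivial left kernel
  have hleft : β.SeparatingLeft := by
    intro v hv
    apply Subtype.ext
    apply hnd
    intro t
    have h0 : tP v t = 0 :=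
      hι ((hβ v t).symm.trans ((hv (QuotientAddGroup.mk t)).trans ι.map_zero.symm))
    rw [← htP, h0, ZeroMemClass.coe_zero]
  -- equal dimensions, hence trivial right kernel
  have hdim : finrank (ZMod p) T[(p : ℤ)] = finrank (ZMod p) (ModN T p) := by
    apply Nat.pow_right_injective hp.out.two_le
    simp only [pow_finrank_eq_natCard, natCard_torsionBy_eq_natCard_modN]
  have hright : β.SeparatingRight :=
    separatingRight_of_separatingLeft_of_finrank_eq β hleft hdim
  -- apply to the class of `x`
  have hx0 : (QuotientAddGroup.mk x : ModN T p) = 0 := by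
    refine hright _ fun v ↦ ?_
    have h0 : tP v x = 0 := Subtype.ext (by
      rw [htP, ZeroMemClass.coe_zero, eq_neg_of_alternating B halt, h _ v.2, neg_zero])
    rw [hβ, h0, map_zero]
  rw [QuotientAddGroup.eq_zero_iff] at hx0
  rwa [range_nsmulAddMonoidHom_eq]

/-- **Rank decomposition of the `p`-torsion.** For a finite abelian group `T` with a nondegenerate
alternating pairing whose `p`-torsion values embed in `𝔽_p`, `#T[p] = #(T[p] ∩ pT) · p^(2j)`: the
radical of the `𝔽_p`-valued form `(x, y) ↦ ι(B(x, y))` on `T[p]` is `T[p] ∩ pT`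
(`mem_range_nsmul_of_forall_torsionBy`), and a complement of the radical carries a nondegenerate
alternating form, of even dimension (`even_finrank_of_isAlt_of_nondegenerate`). [folklore] -/
theorem natCard_torsionBy_eq_mul_sq [Finite T] (B : T →+ T →+ Q) (halt : ∀ x, B x x = 0)
    (hnd : ∀ x, (∀ y, B x y = 0) → x = 0) (ι : Q[(p : ℤ)] →+ ZMod p) (hι : Function.Injective ι) :
    ∃ j : ℕ, Nat.card T[(p : ℤ)] =
      Nat.card ↥(T[(p : ℤ)] ⊓ (nsmulAddMonoidHom (α := T) p).range) * p ^ (2 * j) := by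
  letI : Module (ZMod p) T[(p : ℤ)] := AddSubgroup.torsionBy.zmodModule
  -- the `𝔽_p`-valued form `(v, w) ↦ ι (B v w)` on `V = T[p]`
  let tP : T[(p : ℤ)] →+ T →+ Q[(p : ℤ)] :=
    { toFun := fun v ↦ (B (v : T)).codRestrict (Q[(p : ℤ)]) (apply_mem_torsionBy B p v.2)
      map_zero' := by ext; simp
      map_add' := fun v w ↦ by ext; simp }
  have htP : ∀ (v : T[(p : ℤ)]) (t : T), ((tP v t : Q[(p : ℤ)]) : Q) = B v t := fun _ _ ↦ rfl
  let bT : T[(p : ℤ)] →+ T[(p : ℤ)] →+ ZMod p :=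
    (AddMonoidHom.compHom' (T[(p : ℤ)]).subtype).comp ((AddMonoidHom.compHom ι).comp tP)
  let BV : LinearMap.BilinForm (ZMod p) T[(p : ℤ)] :=
    ((AddMonoidHom.toZModLinearMapEquiv p).toAddMonoidHom.comp bT).toZModLinearMap p
  have hBVapply : ∀ v w : T[(p : ℤ)], BV v w = ι (tP v w) := fun v w ↦ rfl
  have htP0 : ∀ (v : T[(p : ℤ)]) (t : T), B v t = 0 → tP v t = 0 := fun v t h ↦
    Subtype.ext (by rw [htP, h, ZeroMemClass.coe_zero])
  have hBValt : BV.IsAlt := by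
    intro v
    change BV v v = 0
    rw [hBVapply, htP0 v v (halt v), map_zero]
  have hBVrefl : BV.IsRefl := LinearMap.IsAlt.isRefl hBValt
  -- its radical, as an `𝔽_p`-subspace, is `T[p] ∩ pT`
  set Rad : AddSubgroup T[(p : ℤ)] :=
    (T[(p : ℤ)] ⊓ (nsmulAddMonoidHom (α := T) p).range).addSubgroupOf (T[(p : ℤ)]) with hRad
  set RadV : Submodule (ZMod p) T[(p : ℤ)] := AddSubgroup.toZModSubmodule p Rad with hRadV
  have hker : LinearMap.ker BV = RadV := by
    ext v
    rw [LinearMap.mem_ker, hRadV, AddSubgroup.mem_toZModSubmodule, hRad,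
      AddSubgroup.mem_addSubgroupOf, AddSubgroup.mem_inf]
    constructor
    · intro hv
      refine ⟨v.2, mem_range_nsmul_of_forall_torsionBy p B halt hnd ι hι fun y hy ↦ ?_⟩
      have h0 : BV v ⟨y, hy⟩ = 0 := by rw [hv, LinearMap.zero_apply]
      rw [hBVapply] at h0
      rw [← htP v y, hι (h0.trans ι.map_zero.symm), ZeroMemClass.coe_zero]
    · rintro ⟨-, t, ht⟩
      ext w
      rw [LinearMap.zero_apply, hBVapply, htP0 v w ?_, map_zero]
      rw [← ht, nsmulAddMonoidHom_apply]
      exact apply_nsmul_apply_eq_zero B p t w.2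
  -- a complement of the radical is a nondegenerate alternating space, of even dimension
  obtain ⟨U, hU⟩ := Submodule.exists_isCompl RadV
  have hUnd : (BV.restrict U).Nondegenerate := by
    refine (LinearMap.IsRefl.nondegenerate_iff_separatingLeft (B := BV.restrict U)
      fun a b h ↦ hBVrefl (a : T[(p : ℤ)]) (b : T[(p : ℤ)]) h).mpr ?_
    intro u hu
    have hker_u : (u : T[(p : ℤ)]) ∈ LinearMap.ker BV := by
      rw [LinearMap.mem_ker]
      ext v
      rw [LinearMap.zero_apply]
      obtain ⟨k, hk, u', hu', rfl⟩ := Submodule.mem_sup.mp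
        ((hU.sup_eq_top.symm ▸ Submodule.mem_top : v ∈ RadV ⊔ U))
      rw [map_add]
      have h1 : BV u k = 0 := by
        rw [← hker] at hk
        have : BV k u = 0 := by rw [LinearMap.mem_ker.mp hk, LinearMap.zero_apply]
        exact hBVrefl _ _ this
      have h2 : BV u u' = 0 := hu ⟨u', hu'⟩
      rw [h1, h2, add_zero]
    rw [hker] at hker_u
    have : (u : T[(p : ℤ)]) ∈ RadV ⊓ U := ⟨hker_u, u.2⟩
    rw [hU.inf_eq_bot, Submodule.mem_bot] at this
    exact Subtype.ext this
  have hUalt : (BV.restrict U).IsAlt := fun u ↦ hBValt (u : T[(p : ℤ)])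
  haveI : Module.Finite (ZMod p) T[(p : ℤ)] := Module.Finite.of_finite
  obtain ⟨j, hj⟩ := even_finrank_of_isAlt_of_nondegenerate hUalt hUnd
  have hdim : finrank (ZMod p) RadV + finrank (ZMod p) U = finrank (ZMod p) T[(p : ℤ)] :=
    Submodule.finrank_add_eq_of_isCompl hU
  refine ⟨j, ?_⟩
  have hcardRad :
      Nat.card RadV = Nat.card ↥(T[(p : ℤ)] ⊓ (nsmulAddMonoidHom (α := T) p).range) := by
    rw [show Nat.card RadV = Nat.card Rad from rfl, hRad]
    exact Nat.card_congr (AddSubgroup.addSubgroupOfEquivOfLe inf_le_left).toEquiv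
  rw [← hcardRad, ← pow_finrank_eq_natCard p T[(p : ℤ)], ← pow_finrank_eq_natCard p RadV,
    ← pow_add, ← hdim, hj, two_mul]

/-! ### Even `p`-rank -/

/-- **A finite abelian group with a nondegenerate alternating pairing has even `p`-rank**: if
`B : T × T → Q` is bi-additive, alternating (`B(x, x) = 0`) and nondegenerate, and the `p`-torsion
of `Q` embeds in `𝔽_p` (as for `Q = ℚ/ℤ`), then `#T[p] = p^(2k)`, i.e. `dim_{𝔽_p} T[p]` is even.
(Classically: such `T` is of the form `M × M`.) Proof by induction on `#T`: `#T[p] =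
#(T[p] ∩ pT) · p^{2j}` (`natCard_torsionBy_eq_mul_sq`) and `T[p] ∩ pT ≅ (T/T[p])[p]`
(`natCard_torsionBy_quot_eq`), where `T/T[p]` carries the nondegenerate alternating pairing
`B(pa, b)` (`exists_quotTorsionPairing`) and has smaller order unless `T[p] = 0`. [folklore] -/
theorem exists_natCard_torsionBy_eq_pow_two_mul (ι : Q[(p : ℤ)] →+ ZMod p)
    (hι : Function.Injective ι) (T : Type u) [AddCommGroup T] [Finite T] (B : T →+ T →+ Q)
    (halt : ∀ x, B x x = 0) (hnd : ∀ x, (∀ y, B x y = 0) → x = 0) :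
    ∃ k : ℕ, Nat.card T[(p : ℤ)] = p ^ (2 * k) := by
  suffices key : ∀ (n : ℕ) (T : Type u) [AddCommGroup T] [Finite T] (B : T →+ T →+ Q),
      (∀ x, B x x = 0) → (∀ x, (∀ y, B x y = 0) → x = 0) → Nat.card T = n →
      ∃ k : ℕ, Nat.card T[(p : ℤ)] = p ^ (2 * k) from key _ T B halt hnd rfl
  intro n
  induction n using Nat.strong_induction_on with
  | _ n ih =>
  intro T _ _ B halt hnd hn
  by_cases hbot : T[(p : ℤ)] = ⊥
  · exact ⟨0, by rw [hbot, AddSubgroup.card_bot, mul_zero, pow_zero]⟩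
  -- pass to `T' = T / T[p]`, of smaller order
  have hlt : Nat.card (T ⧸ T[(p : ℤ)]) < n := by
    rw [← hn, AddSubgroup.card_eq_card_quotient_mul_card_addSubgroup (T[(p : ℤ)])]
    have h1 : 1 < Nat.card T[(p : ℤ)] := (AddSubgroup.one_lt_card_iff_ne_bot _).mpr hbot
    have h2 : 0 < Nat.card (T ⧸ T[(p : ℤ)]) := Nat.card_pos
    nlinarith
  obtain ⟨B', hB'alt, hB'nd⟩ := exists_quotTorsionPairing p B halt hnd
  obtain ⟨k', hk'⟩ := ih _ hlt (T ⧸ T[(p : ℤ)]) B' hB'alt hB'nd rfl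
  obtain ⟨j, hj⟩ := natCard_torsionBy_eq_mul_sq p B halt hnd ι hι
  refine ⟨k' + j, ?_⟩
  rw [hj, ← natCard_torsionBy_quot_eq, hk', ← pow_add, mul_add]

end FiniteGroup

/-! ### `(ℚ/ℤ)[p] ≅ ℤ/p` -/

section Circle

variable (p : ℕ) [hp : Fact p.Prime]

/-- The element `1/p` of `ℚ/ℤ` has order `p`. [folklore] -/
theorem addOrderOf_one_div : addOrderOf ((((1 : ℚ) / p : ℚ)) : AddCircle (1 : ℚ)) = p := by
  haveI : Fact ((0 : ℚ) < 1) := ⟨one_pos⟩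
  exact AddCircle.addOrderOf_period_div hp.out.pos

/-- **`(ℚ/ℤ)[p] ↪ ℤ/p`**: there is an injective (indeed bijective) additive map from the
`p`-torsion of `ℚ/ℤ = AddCircle (1 : ℚ)` to `ZMod p`, inverse to `m ↦ m/p` (which is injective
because `1/p` has order `p`, and onto the `p`-torsion, which consists of the classes `m/p`,
`0 ≤ m < p`, Mathlib's `AddCircle.nsmul_eq_zero_iff`). [folklore] -/
theorem exists_circleTorsion_toZMod_injective :
    ∃ ι : (AddCircle (1 : ℚ))[(p : ℤ)] →+ ZMod p, Function.Injective ι := by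
  haveI : Fact ((0 : ℚ) < 1) := ⟨one_pos⟩
  set g : AddCircle (1 : ℚ) := (((1 : ℚ) / p : ℚ) : AddCircle (1 : ℚ)) with hg
  -- `j : ℤ/p → ℚ/ℤ`, `m ↦ m/p`
  let j : ZMod p →+ AddCircle (1 : ℚ) := ZMod.lift p ⟨zmultiplesHom (AddCircle (1 : ℚ)) g, by
    change (p : ℤ) • g = 0
    rw [natCast_zsmul, hg, ← AddCircle.coe_nsmul, nsmul_eq_mul,
      mul_one_div_cancel (Nat.cast_ne_zero.mpr hp.out.ne_zero), AddCircle.coe_period]⟩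
  have hj : ∀ m : ℤ, j (m : ZMod p) = m • g := fun m ↦ by
    rw [ZMod.lift_coe]; rfl
  have hjinj : Function.Injective j := by
    rw [ZMod.lift_injective]
    intro m hm
    change m • g = 0 at hm
    rw [← addOrderOf_dvd_iff_zsmul_eq_zero, hg, addOrderOf_one_div] at hm
    exact (ZMod.intCast_zmod_eq_zero_iff_dvd m p).mpr hm
  have hjrange : j.range = (AddCircle (1 : ℚ))[(p : ℤ)] := by
    ext u
    constructor
    · rintro ⟨m, rfl⟩
      rw [AddSubgroup.torsionBy.nsmul_iff, ← map_nsmul, ← Nat.cast_smul_eq_nsmul (ZMod p) p m,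
        ZMod.natCast_self, zero_smul, map_zero]
    · intro hu
      rw [AddSubgroup.torsionBy.nsmul_iff, AddCircle.nsmul_eq_zero_iff hp.out.pos] at hu
      obtain ⟨m, -, rfl⟩ := hu
      refine ⟨(m : ℤ), ?_⟩
      rw [hj, hg, ← AddCircle.coe_zsmul, zsmul_eq_mul, Int.cast_natCast, mul_one, mul_one_div]
  let e : ZMod p ≃+ (AddCircle (1 : ℚ))[(p : ℤ)] :=
    (AddMonoidHom.ofInjective hjinj).trans (AddEquiv.addSubgroupCongr hjrange)
  exact ⟨e.symm.toAddMonoidHom, e.symm.injective⟩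

/-- **Even `p`-rank for `ℚ/ℤ`-valued pairings**: a finite abelian group with a nondegenerate
alternating bi-additive pairing `T × T → ℚ/ℤ` has `#T[p] = p^(2k)` for every prime `p`
(`exists_natCard_torsionBy_eq_pow_two_mul` with `(ℚ/ℤ)[p] ≅ ℤ/p`). This is the group-theoretic
input of "the order of `Ш` is a square" (Cassels 1962) and of the parity relation between
`dim Ш[p]` and `corank Ш[p^∞]`. [folklore] -/
theorem exists_natCard_torsionBy_eq_pow_two_mul_of_circle (T : Type u) [AddCommGroup T]
    [Finite T] (B : T →+ T →+ AddCircle (1 : ℚ)) (halt : ∀ x, B x x = 0)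
    (hnd : ∀ x, (∀ y, B x y = 0) → x = 0) : ∃ k : ℕ, Nat.card T[(p : ℤ)] = p ^ (2 * k) := by
  obtain ⟨ι, hι⟩ := exists_circleTorsion_toZMod_injective p
  exact exists_natCard_torsionBy_eq_pow_two_mul p ι hι T B halt hnd

end Circle

end Literature.GroupTheory.FiniteAbelian

end
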